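import Mathlib.AlgebraicGeometry.EllipticCurve.Affine.Point
import Mathlib.AlgebraicGeometry.EllipticCurve.NormalForms
import Mathlib.Analysis.Complex.Liouville
import Mathlib.Analysis.Complex.RemovableSingularity
import Mathlib.Analysis.Complex.RealDeriv
import Mathlib.Analysis.Meromorphic.Order
import Mathlib.Analysis.ODE.ExistUnique
import Mathlib.Analysis.Normed.Module.Connected
import Mathlib.Analysis.Calculus.ContDiff.RCLike
import Mathlib.Analysis.Calculus.Deriv.Shift
import Mathlib.Analysis.Calculus.Deriv.Prod
import Mathlib.LinearAlgebra.Complex.FiniteDimensional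
import Literature.NumberTheory.EllipticCurves.UniformizationProofs
import Literature.NumberTheory.EllipticCurves.LatticeJInvariant
import Literature.NumberTheory.EllipticCurves.RealLatticePeriodHalfPeriodsProofs
import Literature.NumberTheory.EllipticCurves.RealLatticePeriodProofs
import Literature.NumberTheory.EllipticCurves.VariableChangePoints
import HarnessLib

/-!
# The elliptic curve `E_Λ` of a lattice and the map `ℂ → E_Λ(ℂ)`, `z ↦ (℘(z), ℘'(z)/2)`

Silverman, *The Arithmetic of Elliptic Curves*, Prop. VI.3.6: for a lattice `Λ ⊂ ℂ` with
invariants `g₂ = 60G₄`, `g₃ = 140G₆`,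
(a) `Δ(Λ) = g₂³ − 27g₃² ≠ 0`, so `E_Λ : y² = 4x³ − g₂x − g₃` is an elliptic curve, and
(b) `φ : ℂ/Λ → E_Λ(ℂ)`, `z ↦ [℘(z), ℘'(z), 1]` is a complex analytic isomorphism of complex Lie
groups (a bijective group homomorphism which is biholomorphic). Proved here: (a), and of (b) the
bijectivity (`toPoint_surjective`, `toPoint_eq_toPoint_iff`); the homomorphism property is the
one remaining named fact (`toPoint_add`).

Topic `Literature/NumberTheory/EllipticCurves`; dot-notation extensions of Mathlib's
`PeriodPair` (as in `Uniformization.lean`, `RealLatticePeriod.lean`, `WeierstrassAddition.lean`),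
on top of Mathlib's `℘ = ℘[L]`, `℘' = ℘'[L]`, `PeriodPair.g₂/g₃`, `derivWeierstrassP_sq`
(`℘'² = 4℘³ − g₂℘ − g₃`) and `order_weierstrassP` (double poles on `Λ`), and of the tree's
`RealLatticePeriodHalfPeriodsProofs.lean` (`℘'' = 6℘² − g₂/2`, countability and preconnectedness
lemmas for `Λ`). This file is the second
layer of the decomposition of the named fact
`Literature.NumberTheory.EllipticCurves.ModularForms.nonempty_modularParametrizationData` (`ModularCurve.lean`): its leaf
`Literature.NumberTheory.EllipticCurves.ModularForms.IsNeronLatticeOf.exists_uniformize` (`ModularParametrization.lean`: a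
surjective homomorphism `ℂ →+ W(ℂ)` with kernel the Néron lattice, for any Weierstrass model
`W`) is VI.3.6(b) for `E_Λ` transported along a change of variables, and VI.3.6(b) for `E_Λ` is
reduced here to the single analytic input that `φ` is additive.

## Contents (all in `namespace PeriodPair`, `L : PeriodPair` spanning `Λ = L.lattice`)

* VI.3.6(a), `g₂³ − 27g₃² ≠ 0`, is the tree's `PeriodPair.discr_ne_zero`
  (`LatticeJInvariant.lean`, via `Λ = c·Λ_τ` and Mathlib's `ModularForm.discriminant_ne_zero`
  rather than Silverman's distinctness of the `℘(ωᵢ/2)`); it makes `E_Λ` elliptic: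
* `curve L = E_Λ`, as the Mathlib Weierstrass curve `y² = x³ − (g₂/4)x − g₃/4` (Silverman's
  `Y² = 4X³ − g₂X − g₃` with `Y = 2y`, since Mathlib's cubic is monic), with `c₄ = 12g₂`,
  `c₆ = 216g₃`, `Δ = g₂³ − 27g₃²` and the instance `curve.IsElliptic`;
* `toPoint L : ℂ → E_Λ(ℂ)`, `z ↦ (℘(z), ℘'(z)/2)` off `Λ` and `O` on `Λ` — a genuine definition
  (the points are on `E_Λ` by `derivWeierstrassP_sq`, nonsingular as `E_Λ` is elliptic), with
  `toPoint_eq_zero_iff` (vanishes exactly on `Λ`), `toPoint_add_coe` (`Λ`-periodic),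
  `toPoint_neg` (odd);
* `exists_weierstrassP_eq` — **proved**: `℘` takes every value on `ℂ ∖ Λ` (Liouville applied to
  `(℘ − x)⁻¹` extended by `0` over the poles, Mathlib's removable-singularity theorem,
  boundedness from periodicity via `ZSpan.fract`), whence
  `toPoint_surjective` — **VI.3.6(b), surjectivity, proved**;
* `sub_mem_lattice_of_weierstrassP_eq` — **proved**: `℘(z) = ℘(w)`, `℘'(z) = ℘'(w)` (`z, w ∉ Λ`)
  imply `z ≡ w (mod Λ)` — not by counting zeros of `℘ − ℘(z)` as in Silverman, but by uniqueness
  for the autonomous system `Y' = (Y₂, 6Y₁² − g₂/2)` solved by `(℘, ℘')(z + t)` (Mathlib's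
  `ODE_solution_unique_of_eventually`; `℘'' = 6℘² − g₂/2` is the tree's
  `hasDerivAt_derivWeierstrassP`), analytic continuation, and comparison of poles — the field
  `weierstrassField`, `contDiff_weierstrassField` and `hasDerivAt_weierstrassP_pair` are reused by
  the ODE proof of the addition theorems in `ComplexTorusAddProofs.lean`; whence
  `toPoint_eq_toPoint_iff` — **VI.3.6(b), injectivity modulo `Λ`, proved**:
  `toPoint z = toPoint w ↔ z − w ∈ Λ`;
* `toPoint_add` — NAMED FACT, **VI.3.6(b), additivity**: `toPoint (z + w) = toPoint z + toPoint w`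
  (the addition theorem for `℘` **and `℘'`** against Mathlib's chord-tangent law). Kept as a
  named fact in this file (users take `(h : L.toPoint_add)`); its discharge `toPoint_add_holds`
  is the sibling `ComplexTorusAddProofs.lean`, by cases: `z`, `w` or `z + w ∈ Λ` by
  `toPoint_add_coe`/`toPoint_neg`; the generic case by the addition theorem
  `℘(z + w) = q²/4 − ℘(z) − ℘(w)`, `q = (℘'(z) − ℘'(w))/(℘(z) − ℘(w))` (the statement
  `PeriodPair.weierstrassP_add` of `WeierstrassAddition.lean`, discharged in the tree's
  `WeierstrassAdditionProofs.lean` by the `σ`-function route) together with its companion for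
  the `y`-coordinate, `℘'(z + w) = −(℘'(z) + q(℘(z + w) − ℘(z)))`, both obtained there in one
  stroke by an ODE-uniqueness argument building on `sub_mem_lattice_of_weierstrassP_eq` below; the
  case `z − w ∈ Λ` by the duplication formulas likewise; the cases are separated by
  `℘(z) = ℘(w) ⇒ z ≡ ±w (mod Λ)` (AEC proof of VI.3.6(b), PDF p. 152: `℘ − ℘(w)` is elliptic of
  order `2` with zeros `±w`; here from `sub_mem_lattice_of_weierstrassP_eq`);
* `toPointHom`, `coe_ker_toPointHom`, `toPointHom_surjective`, `exists_addMonoidHom_curve` —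
  given `toPoint_add`, the surjective homomorphism `ℂ →+ E_Λ(ℂ)` with kernel `Λ` of VI.3.6(b);
* `WeierstrassCurve.toShortNF_eq`: Mathlib's change of variables to short normal form is, over
  `ℂ`, `W.toShortNF = (1, −b₂/12, −a₁/2, a₁b₂/24 − a₃/2)` (AEC III.§1, completing square and
  cube), with `toShortNF_smul : W.toShortNF • W = (0, 0, 0, −c₄/48, −c₆/864)`;
  and `exists_addMonoidHom_of_g₂_g₃` — **proved transport**: for any model `W` with
  `g₂(Λ) = c₄(W)/12`, `g₃(Λ) = c₆(W)/216`, given `toPoint_add`, a surjective homomorphism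
  `ℂ →+ W(ℂ)` with kernel `Λ`, `z ↦ (℘(z) − b₂/12, (℘'(z) − a₁x − a₃)/2)` off `Λ` (through the
  tree's proved group isomorphism `WeierstrassCurve.VariableChange.pointEquiv`,
  `VariableChangePoints.lean`). This is literally the conclusion of
  `Literature.NumberTheory.EllipticCurves.ModularForms.IsNeronLatticeOf.exists_uniformize` for `(W, L)`, so that named fact (leaf 3
  of `nonempty_modularParametrizationData`) is reduced to `∀ L, L.toPoint_add`.

Holomorphy of `toPoint` off `Λ` is Mathlib's `differentiableOn_weierstrassP/derivWeierstrassP`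
and is not restated; the complex-manifold structure on `E_Λ(ℂ)` is not needed downstream.

## References

* J. H. Silverman, *The Arithmetic of Elliptic Curves*, 2nd ed., GTM 106, Springer 2009:
  Prop. VI.3.6 (PDF p. 151), Thm. VI.2.1–2.2, Cor. VI.5.1.1.
* J.-P. Serre, *A Course in Arithmetic*, GTM 7, VII §2.2 (lattices `ℤω₁ + ℤω₂` and `Λ_τ`).
-/

noncomputable section

open Complex Filter Topology Bornology Set

namespace PeriodPair

variable (L : PeriodPair)

/-! ### `Δ(Λ) ≠ 0` (Silverman AEC VI.3.6(a))

This is the tree's `PeriodPair.discr_ne_zero` (`LatticeJInvariant.lean`: `Λ = cΛ_τ` with `τ ∈ ℍ`,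
`Δ(cΛ) = c⁻¹²Δ(Λ)`, `Δ(Λ_τ) = (2π)¹²Δ(τ) ≠ 0` by Mathlib's `ModularForm.discriminant_ne_zero`);
it is used below through the instance `curve.IsElliptic`. -/


/-! ### The elliptic curve `E_Λ : y² = x³ − (g₂/4)x − g₃/4` -/

section Curve

/-- The **elliptic curve of the lattice** `Λ`, in Weierstrass form
`E_Λ : y² = x³ − (g₂(Λ)/4) x − g₃(Λ)/4`, i.e. Silverman's `Y² = 4X³ − g₂X − g₃` (AEC VI.3.5(b),
VI.3.6) with `Y = 2y` (Mathlib's `WeierstrassCurve` has monic cubic part, so `(℘, ℘')` on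
`Y² = 4X³ − g₂X − g₃` becomes `(℘, ℘'/2)` on `E_Λ`). Its invariants are `c₄ = 12 g₂`, `c₆ = 216 g₃`,
`Δ = g₂³ − 27g₃²`. [cite: SilvermanAEC2009, Prop. VI.3.6(b)] -/
def curve : WeierstrassCurve ℂ :=
  ⟨0, 0, 0, -L.g₂ / 4, -L.g₃ / 4⟩

/-- `a₁(E_Λ) = 0`. [folklore] -/
@[simp] lemma curve_a₁ : L.curve.a₁ = 0 := rfl

/-- `a₂(E_Λ) = 0`. [folklore] -/
@[simp] lemma curve_a₂ : L.curve.a₂ = 0 := rfl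

/-- `a₃(E_Λ) = 0`. [folklore] -/
@[simp] lemma curve_a₃ : L.curve.a₃ = 0 := rfl

/-- `a₄(E_Λ) = −g₂/4`. [folklore] -/
@[simp] lemma curve_a₄ : L.curve.a₄ = -L.g₂ / 4 := rfl

/-- `a₆(E_Λ) = −g₃/4`. [folklore] -/
@[simp] lemma curve_a₆ : L.curve.a₆ = -L.g₃ / 4 := rfl

/-- `c₄(E_Λ) = 12 g₂(Λ)`. [folklore] -/
lemma curve_c₄ : L.curve.c₄ = 12 * L.g₂ := by
  simp only [WeierstrassCurve.c₄, WeierstrassCurve.b₂, WeierstrassCurve.b₄, curve_a₁, curve_a₂,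
    curve_a₃, curve_a₄]
  ring

/-- `c₆(E_Λ) = 216 g₃(Λ)`. [folklore] -/
lemma curve_c₆ : L.curve.c₆ = 216 * L.g₃ := by
  simp only [WeierstrassCurve.c₆, WeierstrassCurve.b₂, WeierstrassCurve.b₄, WeierstrassCurve.b₆,
    curve_a₁, curve_a₂, curve_a₃, curve_a₄, curve_a₆]
  ring

/-- `Δ(E_Λ) = g₂³ − 27 g₃² = Δ(Λ)`. [folklore] -/
lemma curve_Δ : L.curve.Δ = L.g₂ ^ 3 - 27 * L.g₃ ^ 2 := by
  simp only [WeierstrassCurve.Δ, WeierstrassCurve.b₂, WeierstrassCurve.b₄, WeierstrassCurve.b₆,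
    WeierstrassCurve.b₈, curve_a₁, curve_a₂, curve_a₃, curve_a₄, curve_a₆]
  ring

/-- `E_Λ` is an elliptic curve (`Δ(Λ) ≠ 0`, Silverman AEC VI.3.6(a)). An instance on the
Literature definition `PeriodPair.curve` (no Mathlib instance is shadowed).
[cite: SilvermanAEC2009, Prop. VI.3.6(a)] -/
instance isElliptic_curve : L.curve.IsElliptic := by
  rw [WeierstrassCurve.isElliptic_iff, curve_Δ]
  exact (L.discr_ne_zero).isUnit

/-- The affine equation of `E_Λ`: `y² = x³ − (g₂/4)x − g₃/4`. [folklore] -/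
lemma equation_curve_iff (x y : ℂ) :
    L.curve.toAffine.Equation x y ↔ y ^ 2 = x ^ 3 - L.g₂ / 4 * x - L.g₃ / 4 := by
  rw [WeierstrassCurve.Affine.equation_iff]
  simp only [WeierstrassCurve.toAffine, curve_a₁, curve_a₂, curve_a₃, curve_a₄, curve_a₆]
  constructor <;> intro h <;> linear_combination h

end Curve

/-! ### The map `z ↦ (℘(z), ℘'(z)/2)` -/

section ToPoint

variable {L}

/-- For `z ∉ Λ` the point `(℘(z), ℘'(z)/2)` lies on `E_Λ`: this is `℘'² = 4℘³ − g₂℘ − g₃`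
(Mathlib `PeriodPair.derivWeierstrassP_sq`; Silverman AEC VI.3.5(b)). [folklore] -/
theorem equation_weierstrassP {z : ℂ} (hz : z ∉ L.lattice) :
    L.curve.toAffine.Equation (℘[L] z) (℘'[L] z / 2) := by
  rw [equation_curve_iff]
  linear_combination (1 / 4 : ℂ) * L.derivWeierstrassP_sq z hz

/-- For `z ∉ Λ` the point `(℘(z), ℘'(z)/2)` is a nonsingular point of `E_Λ` (every point of an
elliptic curve is nonsingular). [folklore] -/
theorem nonsingular_weierstrassP {z : ℂ} (hz : z ∉ L.lattice) :
    L.curve.toAffine.Nonsingular (℘[L] z) (℘'[L] z / 2) :=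
  (WeierstrassCurve.Affine.equation_iff_nonsingular (W := L.curve)).mp (equation_weierstrassP hz)

variable (L)

open Classical in
/-- **The map `ℂ → E_Λ(ℂ)`, `z ↦ (℘(z), ℘'(z)/2)`** (and `z ↦ O` for `z ∈ Λ`), i.e. Silverman's
`φ : ℂ/Λ → E(ℂ)`, `z ↦ [℘(z), ℘'(z), 1]` (AEC Prop. VI.3.6(b)) composed with `ℂ → ℂ/Λ` and written
on `E_Λ : y² = x³ − (g₂/4)x − g₃/4`. It is `Λ`-periodic and odd (`toPoint_add_coe`,
`toPoint_neg`), vanishes exactly on `Λ` (`toPoint_eq_zero_iff`) and is onto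
(`toPoint_surjective`); that it is additive is the named fact `toPoint_add`.
[cite: SilvermanAEC2009, Prop. VI.3.6(b)] -/
def toPoint (z : ℂ) : L.curve.toAffine.Point :=
  if hz : z ∈ L.lattice then 0 else .some _ _ (nonsingular_weierstrassP hz)

variable {L}

/-- `toPoint` is `O` on the lattice. [folklore] -/
@[simp] theorem toPoint_of_mem {z : ℂ} (hz : z ∈ L.lattice) : L.toPoint z = 0 := by
  rw [toPoint, dif_pos hz]

/-- `toPoint z = (℘(z), ℘'(z)/2)` off the lattice. [folklore] -/
theorem toPoint_of_notMem {z : ℂ} (hz : z ∉ L.lattice) :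
    L.toPoint z = .some _ _ (nonsingular_weierstrassP hz) := by
  rw [toPoint, dif_neg hz]

/-- `toPoint 0 = O`. [folklore] -/
@[simp] theorem toPoint_zero : L.toPoint 0 = 0 :=
  toPoint_of_mem (zero_mem _)

/-- `toPoint z = O ↔ z ∈ Λ`. [folklore] -/
theorem toPoint_eq_zero_iff {z : ℂ} : L.toPoint z = 0 ↔ z ∈ L.lattice := by
  refine ⟨fun h ↦ ?_, toPoint_of_mem⟩
  by_contra hz
  rw [toPoint_of_notMem hz] at h
  exact WeierstrassCurve.Affine.Point.some_ne_zero _ h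

/-- `toPoint` is `Λ`-periodic. [folklore] -/
theorem toPoint_add_coe (z : ℂ) (l : L.lattice) : L.toPoint (z + l) = L.toPoint z := by
  by_cases hz : z ∈ L.lattice
  · rw [toPoint_of_mem hz, toPoint_of_mem (add_mem hz l.2)]
  · have hz' : z + l ∉ L.lattice := fun h ↦ hz (by simpa using sub_mem h l.2)
    rw [toPoint_of_notMem hz, toPoint_of_notMem hz']
    simp only [L.weierstrassP_add_coe, L.derivWeierstrassP_add_coe]

/-- `toPoint` is odd: `toPoint (−z) = −toPoint z` (`℘` is even, `℘'` odd, and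
`−(x, y) = (x, −y)` on `E_Λ`). [folklore] -/
theorem toPoint_neg (z : ℂ) : L.toPoint (-z) = -L.toPoint z := by
  by_cases hz : z ∈ L.lattice
  · rw [toPoint_of_mem hz, toPoint_of_mem (neg_mem hz), neg_zero]
  · have hz' : -z ∉ L.lattice := fun h ↦ hz (by simpa using neg_mem h)
    rw [toPoint_of_notMem hz, toPoint_of_notMem hz', WeierstrassCurve.Affine.Point.neg_some]
    simp only [L.weierstrassP_neg, L.derivWeierstrassP_neg, WeierstrassCurve.Affine.negY,
      WeierstrassCurve.toAffine, curve_a₁, curve_a₃]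
    congr 1
    ring

variable (L)

/-- NAMED FACT — **`z ↦ (℘(z), ℘'(z)/2)` is a group homomorphism `ℂ → E_Λ(ℂ)`**
(Silverman AEC Prop. VI.3.6(b): `φ : ℂ/Λ → E(ℂ)` is "a group homomorphism"; Silverman's proof
(PDF p. 152) takes `f ∈ ℂ(Λ)` with divisor `(z₁ + z₂) − (z₁) − (z₂) + (0)` (VI.3.4), writes
`f = F(℘, ℘')` (VI.3.2) and reads off `φ(z₁ + z₂) = φ(z₁) + φ(z₂)` from `div F` by III.3.5;
equivalently the addition theorems for `℘` and `℘'`, cf. the named facts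
`PeriodPair.weierstrassP_add`, `weierstrassP_two_mul` of `WeierstrassAddition.lean` and the
module docstring for the discharge `toPoint_add_holds`, file `ComplexTorusAddProofs.lean`).
Users take `(h : L.toPoint_add)`. [cite: SilvermanAEC2009, Prop. VI.3.6(b)] -/
def toPoint_add : Prop :=
  ∀ z w : ℂ, L.toPoint (z + w) = L.toPoint z + L.toPoint w

variable {L}

/-- The homomorphism `ℂ →+ E_Λ(ℂ)` underlying `toPoint`, given its additivity
(`toPoint_add`). [folklore] -/
def toPointHom (h : L.toPoint_add) : ℂ →+ L.curve.toAffine.Point where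
  toFun := L.toPoint
  map_zero' := toPoint_zero
  map_add' := h

/-- `toPointHom` is `toPoint` as a function (by definition). [folklore] -/
@[simp] theorem toPointHom_apply (h : L.toPoint_add) (z : ℂ) : toPointHom h z = L.toPoint z :=
  rfl

/-- The kernel of `ℂ →+ E_Λ(ℂ)` is exactly the lattice. [folklore] -/
theorem coe_ker_toPointHom (h : L.toPoint_add) :
    ((toPointHom h).ker : Set ℂ) = L.lattice := by
  ext z
  simp [AddMonoidHom.mem_ker, toPoint_eq_zero_iff]

end ToPoint

/-! ### `℘` takes every value, and `toPoint` is onto (Silverman AEC VI.3.6(b)) -/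

section Surjective

variable {L}

/-- `℘(z) → ∞` as `z → l₀ ∈ Λ` (double pole; Mathlib `PeriodPair.order_weierstrassP`).
[folklore] -/
theorem tendsto_weierstrassP_cobounded {l₀ : ℂ} (h : l₀ ∈ L.lattice) :
    Tendsto ℘[L] (𝓝[≠] l₀) (cobounded ℂ) :=
  tendsto_cobounded_of_meromorphicOrderAt_neg (by
    rw [L.order_weierstrassP l₀ h, ← show ((-2 : ℤ) : WithTop ℤ) = -2 by norm_num]
    exact_mod_cast (by norm_num : (-2 : ℤ) < 0))

/-- `(℘(z) − x)⁻¹ → 0` as `z → l₀ ∈ Λ`. [folklore] -/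
theorem tendsto_inv_weierstrassP_sub {l₀ : ℂ} (h : l₀ ∈ L.lattice) (x : ℂ) :
    Tendsto (fun z ↦ (℘[L] z - x)⁻¹) (𝓝[≠] l₀) (𝓝 0) := by
  have h0 := tendsto_weierstrassP_cobounded h
  rw [← tendsto_norm_atTop_iff_cobounded] at h0
  have h1 : Tendsto (fun z ↦ ℘[L] z - x) (𝓝[≠] l₀) (cobounded ℂ) := by
    rw [← tendsto_norm_atTop_iff_cobounded]
    refine tendsto_atTop_mono (fun z ↦ ?_) (tendsto_atTop_add_const_right _ (-‖x‖) h0)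
    calc ‖℘[L] z‖ + -‖x‖ = ‖℘[L] z‖ - ‖x‖ := by ring
      _ ≤ ‖℘[L] z - x‖ := norm_sub_norm_le _ _
  exact tendsto_inv₀_cobounded.comp h1

variable (L)

open Classical in
/-- **`℘` takes every complex value** on `ℂ ∖ Λ` (Silverman AEC, proof of Prop. VI.3.6(b):
"`℘(z) − x` is a nonconstant elliptic function, so it has a zero", via VI.2.1). Proof here by
Liouville: if `℘ − x` had no zero, `z ↦ (℘(z) − x)⁻¹`, extended by `0` over `Λ` (where
`℘ → ∞`), would be an entire `Λ`-periodic function, bounded since its values are attained on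
the (bounded) fundamental parallelogram, hence constant `= 0`, which is absurd.
[cite: SilvermanAEC2009, Prop. VI.3.6(b) (proof)] -/
theorem exists_weierstrassP_eq (x : ℂ) : ∃ z ∉ L.lattice, ℘[L] z = x := by
  by_contra! H
  set g : ℂ → ℂ := fun z ↦ if z ∈ L.lattice then 0 else (℘[L] z - x)⁻¹ with hg
  have hopen : IsOpen ((L.lattice : Set ℂ)ᶜ) := L.isClosed_lattice.isOpen_compl
  -- `g` is differentiable off the lattice
  have hdiff_off : ∀ z ∉ L.lattice, DifferentiableAt ℂ g z := by
    intro z hz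
    have hev : g =ᶠ[𝓝 z] fun w ↦ (℘[L] w - x)⁻¹ := by
      filter_upwards [hopen.mem_nhds hz] with w hw
      exact if_neg hw
    exact (((L.differentiableOn_weierstrassP.differentiableAt (hopen.mem_nhds hz)).sub_const
      x).inv (sub_ne_zero.mpr (H z hz))).congr_of_eventuallyEq hev
  -- `g` is continuous at the lattice points
  have hcont : ∀ l₀ ∈ L.lattice, ContinuousAt g l₀ := by
    intro l₀ hl₀
    rw [← continuousWithinAt_compl_self, ContinuousWithinAt, show g l₀ = 0 from if_pos hl₀]
    have hev : (fun w ↦ (℘[L] w - x)⁻¹) =ᶠ[𝓝[≠] l₀] g := by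
      filter_upwards [mem_nhdsWithin_of_mem_nhds (L.compl_lattice_sdiff_singleton_mem_nhds l₀),
        self_mem_nhdsWithin] with w hw hw'
      have hwl : w ∉ L.lattice := fun h' ↦ hw ⟨h', hw'⟩
      exact (if_neg hwl).symm
    exact (tendsto_inv_weierstrassP_sub hl₀ x).congr' hev
  -- hence `g` is entire (removable singularities at the lattice points)
  have hdiff : Differentiable ℂ g := by
    intro z
    by_cases hz : z ∈ L.lattice
    · have hs : (L.lattice \ {z} : Set ℂ)ᶜ ∈ 𝓝 z := L.compl_lattice_sdiff_singleton_mem_nhds z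
      have hd : DifferentiableOn ℂ g ((L.lattice \ {z} : Set ℂ)ᶜ \ {z}) := by
        intro w hw
        have hwl : w ∉ L.lattice := fun h' ↦ hw.1 ⟨h', hw.2⟩
        exact (hdiff_off w hwl).differentiableWithinAt
      exact ((Complex.differentiableOn_compl_singleton_and_continuousAt_iff hs).mp
        ⟨hd, hcont z hz⟩).differentiableAt hs
    · exact hdiff_off z hz
  -- `g` is `Λ`-periodic
  have hper : ∀ (z : ℂ) (l : L.lattice), g (z + l) = g z := by
    intro z l
    by_cases hz : z ∈ L.lattice
    · rw [hg]
      simp only [if_pos hz, if_pos (add_mem hz l.2)]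
    · have hz' : z + ↑l ∉ L.lattice := fun h' ↦ hz (by simpa using sub_mem h' l.2)
      rw [hg]
      simp only [if_neg hz, if_neg hz', L.weierstrassP_add_coe]
  -- `g` is bounded: its values are attained on the fundamental parallelogram of `(ω₁, ω₂)`
  have hbdd : IsBounded (Set.range g) := by
    have hK : IsCompact (closure (ZSpan.fundamentalDomain L.basis)) :=
      (ZSpan.fundamentalDomain_isBounded L.basis).isCompact_closure
    refine (hK.image hdiff.continuous).isBounded.subset ?_
    rintro _ ⟨z, rfl⟩
    refine ⟨ZSpan.fract L.basis z, subset_closure (ZSpan.fract_mem_fundamentalDomain _ _), ?_⟩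
    have hmem : ((ZSpan.floor L.basis z : Submodule.span ℤ (Set.range L.basis)) : ℂ) ∈
        L.lattice := by
      rw [L.lattice_eq_span_range_basis]
      exact (ZSpan.floor L.basis z).2
    have hz : z = ZSpan.fract L.basis z + (ZSpan.floor L.basis z : ℂ) := by
      rw [ZSpan.fract_apply]
      ring
    conv_rhs => rw [hz]
    exact (hper _ ⟨_, hmem⟩).symm
  -- Liouville: `g` is constant, `= g 0 = 0`; but `g (ω₁/2) = (℘(ω₁/2) − x)⁻¹ ≠ 0`
  have hconst := hdiff.apply_eq_apply_of_bounded hbdd (L.ω₁ / 2) 0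
  rw [show g 0 = 0 from if_pos (zero_mem _),
    show g (L.ω₁ / 2) = (℘[L] (L.ω₁ / 2) - x)⁻¹ from if_neg L.ω₁_div_two_notMem_lattice,
    inv_eq_zero, sub_eq_zero] at hconst
  exact H _ L.ω₁_div_two_notMem_lattice hconst

/-- **`toPoint : ℂ → E_Λ(ℂ)` is surjective** (Silverman AEC Prop. VI.3.6(b), surjectivity of
`φ`: given `(x, y) ∈ E(ℂ)`, pick `z` with `℘(z) = x`; then `℘'(z)/2 = ±y`, and replace `z` by
`−z` if necessary). [cite: SilvermanAEC2009, Prop. VI.3.6(b)] -/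
theorem toPoint_surjective : Function.Surjective L.toPoint := by
  rintro (_ | ⟨x, y, h⟩)
  · exact ⟨0, toPoint_zero⟩
  · obtain ⟨z, hz, hx⟩ := L.exists_weierstrassP_eq x
    have h1 : y ^ 2 = x ^ 3 - L.g₂ / 4 * x - L.g₃ / 4 := (L.equation_curve_iff x y).mp h.1
    have h2 := (L.equation_curve_iff _ _).mp (equation_weierstrassP hz)
    rw [hx, ← h1] at h2
    rcases sq_eq_sq_iff_eq_or_eq_neg.mp h2 with hy | hy
    · refine ⟨z, ?_⟩
      rw [toPoint_of_notMem hz]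
      subst hx
      simp only [hy]
    · refine ⟨-z, ?_⟩
      have hz' : -z ∉ L.lattice := fun h' ↦ hz (by simpa using neg_mem h')
      rw [toPoint_of_notMem hz']
      subst hx
      simp only [WeierstrassCurve.Affine.Point.some.injEq, L.weierstrassP_neg,
        L.derivWeierstrassP_neg, true_and]
      rw [neg_div, hy, neg_neg]

variable {L}

/-- The homomorphism `ℂ →+ E_Λ(ℂ)` is onto. [folklore] -/
theorem toPointHom_surjective (h : L.toPoint_add) : Function.Surjective (toPointHom h) :=
  L.toPoint_surjective

/-- **Silverman AEC VI.3.6(b) for `E_Λ`, assembled**: given the additivity of `toPoint`, there is a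
surjective group homomorphism `u : ℂ →+ E_Λ(ℂ)` with kernel `Λ` which is
`z ↦ (℘(z), ℘'(z)/2)` off `Λ`. [cite: SilvermanAEC2009, Prop. VI.3.6(b)] -/
theorem exists_addMonoidHom_curve (h : L.toPoint_add) :
    ∃ u : ℂ →+ L.curve.toAffine.Point,
      (u.ker : Set ℂ) = L.lattice ∧ Function.Surjective u ∧
        ∀ z, z ∉ L.lattice → ∃ hz, u z = .some (℘[L] z) (℘'[L] z / 2) hz :=
  ⟨toPointHom h, coe_ker_toPointHom h, toPointHom_surjective h,
    fun _ hz ↦ ⟨nonsingular_weierstrassP hz, toPoint_of_notMem hz⟩⟩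

end Surjective

/-! ### `(℘, ℘')` separates `ℂ/Λ`: `toPoint` is injective modulo `Λ` (Silverman AEC VI.3.6(b)) -/

section Injective

variable {L}

variable (L)

/-- The vector field `(x, y) ↦ (y, 6x² − g₂/2)` of the first-order system satisfied by
`(℘, ℘')` (`℘'' = 6℘² − g₂/2`, Whittaker–Watson §20.22). [folklore] -/
def weierstrassField (Y : ℂ × ℂ) : ℂ × ℂ :=
  (Y.2, 6 * Y.1 ^ 2 - L.g₂ / 2)

/-- The vector field is `C¹` (indeed polynomial). [folklore] -/
theorem contDiff_weierstrassField : ContDiff ℝ 1 L.weierstrassField := by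
  unfold weierstrassField
  fun_prop

/-- Along a real segment, `t ↦ (℘(z + t), ℘'(z + t))` solves `Y' = F(Y)` for the field
`F = weierstrassField` wherever `z + t ∉ Λ` (`deriv ℘ = ℘'` and `℘'' = 6℘² − g₂/2`, the latter
the tree's `PeriodPair.hasDerivAt_derivWeierstrassP`). [folklore] -/
theorem hasDerivAt_weierstrassP_pair {z : ℂ} {t : ℝ} (hzt : z + t ∉ L.lattice) :
    HasDerivAt (fun s : ℝ ↦ (℘[L] (z + s), ℘'[L] (z + s)))
      (L.weierstrassField (℘[L] (z + t), ℘'[L] (z + t))) t := by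
  have h1 : HasDerivAt (fun s : ℝ ↦ ℘[L] (z + s)) (℘'[L] (z + t)) t :=
    (HasDerivAt.comp_const_add z (t : ℂ) (hasDerivAt_weierstrassP hzt)).comp_ofReal
  have h2 : HasDerivAt (fun s : ℝ ↦ ℘'[L] (z + s)) (6 * ℘[L] (z + t) ^ 2 - L.g₂ / 2) t :=
    (HasDerivAt.comp_const_add z (t : ℂ) (L.hasDerivAt_derivWeierstrassP hzt)).comp_ofReal
  exact h1.prodMk h2

/-- **`(℘, ℘')` separates points of `ℂ/Λ`** (Silverman AEC Prop. VI.3.6(b), injectivity of `φ`):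
if `z, w ∉ Λ`, `℘(z) = ℘(w)` and `℘'(z) = ℘'(w)` then `z ≡ w (mod Λ)`. Silverman counts the zeros
of the order-`2` elliptic function `℘ − ℘(z)` (PDF p. 152); the proof here avoids zero counting:
`t ↦ (℘, ℘')(z + t)` and `t ↦ (℘, ℘')(w + t)` solve the same autonomous system
`Y' = (Y₂, 6Y₁² − g₂/2)` with the same initial value, so they agree for small real `t` (Mathlib's
`ODE_solution_unique_of_eventually`), hence `℘(z + ζ) = ℘(w + ζ)` on the connected open set
`{ζ | z + ζ, w + ζ ∉ Λ}` (identity theorem), and comparing the pole of the left side at `ζ = −z`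
with the right side forces `w − z ∈ Λ`. [cite: SilvermanAEC2009, Prop. VI.3.6(b)] -/
theorem sub_mem_lattice_of_weierstrassP_eq {z w : ℂ} (hz : z ∉ L.lattice) (hw : w ∉ L.lattice)
    (h₁ : ℘[L] z = ℘[L] w) (h₂ : ℘'[L] z = ℘'[L] w) : z - w ∈ L.lattice := by
  -- Step 1: local agreement along real `t` near `0`, by uniqueness for `Y' = F(Y)`.
  set Y₁ : ℝ → ℂ × ℂ := fun s ↦ (℘[L] (z + s), ℘'[L] (z + s)) with hY₁
  set Y₂ : ℝ → ℂ × ℂ := fun s ↦ (℘[L] (w + s), ℘'[L] (w + s)) with hY₂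
  have hY0 : Y₁ 0 = Y₂ 0 := by simp [hY₁, hY₂, h₁, h₂]
  obtain ⟨K, S, hS, hK⟩ := (L.contDiff_weierstrassField.contDiffAt
    (x := (℘[L] z, ℘'[L] z))).exists_lipschitzOnWith
  have hopen : IsOpen ((L.lattice : Set ℂ)ᶜ) := L.isClosed_lattice.isOpen_compl
  have hz_ev : ∀ᶠ s : ℝ in 𝓝 0, z + (s : ℂ) ∉ L.lattice := by
    have hc : Continuous fun s : ℝ ↦ z + (s : ℂ) := by fun_prop
    have : (fun s : ℝ ↦ z + (s : ℂ)) ⁻¹' (L.lattice : Set ℂ)ᶜ ∈ 𝓝 (0 : ℝ) :=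
      hc.continuousAt.preimage_mem_nhds (hopen.mem_nhds (by simpa using hz))
    filter_upwards [this] with s hs using hs
  have hw_ev : ∀ᶠ s : ℝ in 𝓝 0, w + (s : ℂ) ∉ L.lattice := by
    have hc : Continuous fun s : ℝ ↦ w + (s : ℂ) := by fun_prop
    have : (fun s : ℝ ↦ w + (s : ℂ)) ⁻¹' (L.lattice : Set ℂ)ᶜ ∈ 𝓝 (0 : ℝ) :=
      hc.continuousAt.preimage_mem_nhds (hopen.mem_nhds (by simpa using hw))
    filter_upwards [this] with s hs using hs
  have hY₁d : ∀ᶠ s : ℝ in 𝓝 0, HasDerivAt Y₁ (L.weierstrassField (Y₁ s)) s := by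
    filter_upwards [hz_ev] with s hs using L.hasDerivAt_weierstrassP_pair hs
  have hY₂d : ∀ᶠ s : ℝ in 𝓝 0, HasDerivAt Y₂ (L.weierstrassField (Y₂ s)) s := by
    filter_upwards [hw_ev] with s hs using L.hasDerivAt_weierstrassP_pair hs
  have hY₁S : ∀ᶠ s : ℝ in 𝓝 0, Y₁ s ∈ S := by
    have hc : ContinuousAt Y₁ 0 := (hY₁d.self_of_nhds).continuousAt
    refine hc.preimage_mem_nhds ?_
    have : Y₁ 0 = (℘[L] z, ℘'[L] z) := by simp [hY₁]
    rwa [this]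
  have hY₂S : ∀ᶠ s : ℝ in 𝓝 0, Y₂ s ∈ S := by
    have hc : ContinuousAt Y₂ 0 := (hY₂d.self_of_nhds).continuousAt
    refine hc.preimage_mem_nhds ?_
    have : Y₂ 0 = (℘[L] z, ℘'[L] z) := by simp [hY₂, h₁, h₂]
    rwa [this]
  have hloc : Y₁ =ᶠ[𝓝 0] Y₂ :=
    ODE_solution_unique_of_eventually (v := fun _ ↦ L.weierstrassField) (s := fun _ ↦ S)
      (Eventually.of_forall fun _ ↦ hK) (hY₁d.and hY₁S) (hY₂d.and hY₂S) hY0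
  -- Step 2: analytic continuation to `U = {ζ | z + ζ ∉ Λ ∧ w + ζ ∉ Λ}`.
  set F₁ : ℂ → ℂ := fun ζ ↦ ℘[L] (z + ζ) with hF₁
  set F₂ : ℂ → ℂ := fun ζ ↦ ℘[L] (w + ζ) with hF₂
  set U : Set ℂ := {ζ | z + ζ ∉ L.lattice ∧ w + ζ ∉ L.lattice} with hU
  have hUeq : U = ((fun l : ℂ ↦ l - z) '' (L.lattice : Set ℂ) ∪
      (fun l : ℂ ↦ l - w) '' (L.lattice : Set ℂ))ᶜ := by
    ext ζ
    simp only [hU, mem_setOf_eq, mem_compl_iff, mem_union, mem_image, SetLike.mem_coe, not_or,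
      not_exists, not_and]
    constructor
    · rintro ⟨h1, h2⟩
      exact ⟨fun l hl h ↦ h1 (by rw [← h]; simpa using hl),
        fun l hl h ↦ h2 (by rw [← h]; simpa using hl)⟩
    · rintro ⟨h1, h2⟩
      exact ⟨fun h ↦ h1 _ h (by ring), fun h ↦ h2 _ h (by ring)⟩
  have hUpre : IsPreconnected U := by
    rw [hUeq]
    exact (Set.Countable.isConnected_compl_of_one_lt_rank (by simp)
      ((L.countable_lattice.image _).union (L.countable_lattice.image _))).isPreconnected
  have hF₁an : AnalyticOnNhd ℂ F₁ U := fun ζ hζ ↦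
    (L.analyticOnNhd_weierstrassP (z + ζ) hζ.1).comp (by fun_prop)
  have hF₂an : AnalyticOnNhd ℂ F₂ U := fun ζ hζ ↦
    (L.analyticOnNhd_weierstrassP (w + ζ) hζ.2).comp (by fun_prop)
  have h0U : (0 : ℂ) ∈ U := ⟨by simpa using hz, by simpa using hw⟩
  have hfreq : ∃ᶠ ζ in 𝓝[≠] (0 : ℂ), F₁ ζ = F₂ ζ := by
    have hreal : ∀ᶠ s : ℝ in 𝓝[≠] 0, F₁ (s : ℂ) = F₂ (s : ℂ) := by
      filter_upwards [mem_nhdsWithin_of_mem_nhds hloc] with s hs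
      simpa [hY₁, hY₂, hF₁, hF₂] using congrArg Prod.fst hs
    have htend : Tendsto (fun s : ℝ ↦ (s : ℂ)) (𝓝[≠] 0) (𝓝[≠] 0) := by
      have h := (continuous_ofReal.continuousWithinAt (s := {(0 : ℝ)}ᶜ) (x := 0)).tendsto_nhdsWithin
        (t := {(0 : ℂ)}ᶜ) (fun s hs ↦ by simpa using hs)
      simpa using h
    exact htend.frequently hreal.frequently
  have hEq : EqOn F₁ F₂ U :=
    hF₁an.eqOn_of_preconnected_of_frequently_eq hF₂an hUpre h0U hfreq
  -- Step 3: compare the pole of `F₁` at `ζ₀ = -z` with `F₂`.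
  by_contra hzw
  have hwz : w + -z ∉ L.lattice := fun h ↦ hzw (by
    have h' := neg_mem h
    rwa [show -(w + -z) = z - w by ring] at h')
  have ht : Tendsto (fun ζ ↦ z + ζ) (𝓝[≠] (-z)) (𝓝[≠] 0) := by
    refine tendsto_nhdsWithin_of_tendsto_nhds_of_eventually_within _ ?_ ?_
    · have hc : Continuous fun ζ : ℂ ↦ z + ζ := by fun_prop
      have h := hc.tendsto (-z)
      simp only [add_neg_cancel] at h
      exact h.mono_left nhdsWithin_le_nhds
    · filter_upwards [self_mem_nhdsWithin] with ζ (hζ : ζ ≠ -z)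
      simpa [add_eq_zero_iff_eq_neg', eq_comm] using hζ
  have hF₂c : Tendsto F₂ (𝓝[≠] (-z)) (𝓝 (F₂ (-z))) := by
    have : ContinuousAt F₂ (-z) :=
      ((L.differentiableOn_weierstrassP.differentiableAt
        (hopen.mem_nhds (by simpa using hwz))).continuousAt).comp (by fun_prop)
    exact this.continuousWithinAt.tendsto
  have hF₁c : Tendsto F₁ (𝓝[≠] (-z)) (cobounded ℂ) := by
    have h0 : Tendsto ℘[L] (𝓝[≠] 0) (cobounded ℂ) :=
      tendsto_cobounded_of_meromorphicOrderAt_neg (by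
        rw [L.order_weierstrassP 0 (zero_mem _)]; decide)
    exact h0.comp ht
  have hEq' : F₁ =ᶠ[𝓝[≠] (-z)] F₂ := by
    have h1 : ∀ᶠ ζ in 𝓝[≠] (-z), z + ζ ∉ L.lattice :=
      ht.eventually L.eventually_nhdsNE_notMem_lattice
    have h2 : ∀ᶠ ζ in 𝓝[≠] (-z), w + ζ ∉ L.lattice := by
      have hc : Continuous fun ζ : ℂ ↦ w + ζ := by fun_prop
      have : (fun ζ : ℂ ↦ w + ζ) ⁻¹' (L.lattice : Set ℂ)ᶜ ∈ 𝓝 (-z) :=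
        hc.continuousAt.preimage_mem_nhds (hopen.mem_nhds (by simpa using hwz))
      exact mem_nhdsWithin_of_mem_nhds this
    filter_upwards [h1, h2] with ζ hζ1 hζ2 using hEq ⟨hζ1, hζ2⟩
  exact (hF₂c.congr' hEq'.symm).not_tendsto (Metric.disjoint_nhds_cobounded _) hF₁c

/-- **`toPoint` is injective modulo `Λ`** (Silverman AEC Prop. VI.3.6(b), injectivity):
`toPoint z = toPoint w ↔ z − w ∈ Λ`. With `toPoint_surjective`, `toPoint` induces a bijection
`ℂ/Λ ≃ E_Λ(ℂ)`; that it is a homomorphism is the named fact `toPoint_add`.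
[cite: SilvermanAEC2009, Prop. VI.3.6(b)] -/
theorem toPoint_eq_toPoint_iff {z w : ℂ} : L.toPoint z = L.toPoint w ↔ z - w ∈ L.lattice := by
  refine ⟨fun h ↦ ?_, fun h ↦ ?_⟩
  · by_cases hz : z ∈ L.lattice
    · have hw : w ∈ L.lattice := toPoint_eq_zero_iff.mp (by rw [← h, toPoint_of_mem hz])
      exact sub_mem hz hw
    · by_cases hw : w ∈ L.lattice
      · exact absurd (toPoint_eq_zero_iff.mp (by rw [h, toPoint_of_mem hw])) hz
      · rw [toPoint_of_notMem hz, toPoint_of_notMem hw,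
          WeierstrassCurve.Affine.Point.some.injEq] at h
        exact L.sub_mem_lattice_of_weierstrassP_eq hz hw h.1 (by
          have h2 := h.2
          field_simp at h2
          linear_combination h2)
  · have := toPoint_add_coe w ⟨z - w, h⟩
    rw [show w + ((⟨z - w, h⟩ : L.lattice) : ℂ) = z by simp] at this
    exact this

end Injective

/-! ### Transport to an arbitrary Weierstrass model with `c₄ = 12g₂`, `c₆ = 216g₃` -/

section Model

variable {L}

/-- Mathlib's change of variables `WeierstrassCurve.toShortNF` to short normal form, made
explicit over `ℂ`: `(u, r, s, t) = (1, −b₂/12, −a₁/2, a₁b₂/24 − a₃/2)`, the substitutions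
completing the square and the cube (Silverman AEC III.§1, giving (b) and (c) of p. 42, composed).
A deliberate dot-notation extension of Mathlib's `WeierstrassCurve` namespace (like the tree's
`VariableChangePoints.lean`). [cite: SilvermanAEC2009, III.1] -/
theorem _root_.WeierstrassCurve.toShortNF_eq (W : WeierstrassCurve ℂ) :
    W.toShortNF = ⟨1, -W.b₂ / 12, -W.a₁ / 2, W.a₁ * W.b₂ / 24 - W.a₃ / 2⟩ := by
  ext <;> simp only [WeierstrassCurve.toShortNF, WeierstrassCurve.toCharNeTwoNF,
    WeierstrassCurve.VariableChange.mul_def, WeierstrassCurve.variableChange_a₂,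
    WeierstrassCurve.b₂, invOf_eq_inv, inv_one, Units.val_one, one_pow, one_mul, mul_one] <;>
    ring

/-- The short model of `W` over `ℂ`: `W.toShortNF • W = (0, 0, 0, −c₄/48, −c₆/864)`
(dot-notation extension of Mathlib's `WeierstrassCurve` namespace).
[cite: SilvermanAEC2009, III.1] -/
theorem _root_.WeierstrassCurve.toShortNF_smul (W : WeierstrassCurve ℂ) :
    W.toShortNF • W = ⟨0, 0, 0, -W.c₄ / 48, -W.c₆ / 864⟩ := by
  rw [W.toShortNF_eq]
  ext <;> simp only [WeierstrassCurve.variableChange_a₁,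
    WeierstrassCurve.variableChange_a₂, WeierstrassCurve.variableChange_a₃,
    WeierstrassCurve.variableChange_a₄, WeierstrassCurve.variableChange_a₆, WeierstrassCurve.b₂,
    WeierstrassCurve.b₄, WeierstrassCurve.b₆, WeierstrassCurve.c₄, WeierstrassCurve.c₆, inv_one,
    Units.val_one, one_pow, one_mul] <;> ring

/-- If `g₂(Λ) = c₄(W)/12` and `g₃(Λ) = c₆(W)/216` then the short model of `W` is `E_Λ`.
[folklore] -/
theorem toShortNF_smul_eq_curve {W : WeierstrassCurve ℂ} (h₂ : L.g₂ = W.c₄ / 12)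
    (h₃ : L.g₃ = W.c₆ / 216) : W.toShortNF • W = L.curve := by
  rw [W.toShortNF_smul, curve, h₂, h₃]
  congr 1 <;> ring

open Classical in
/-- **Silverman AEC VI.3.6(b) for an arbitrary model.** Let `W` be a Weierstrass model over `ℂ`
with `g₂(Λ) = c₄(W)/12`, `g₃(Λ) = c₆(W)/216` (i.e. `Λ` is the period lattice of
`ω = dx/(2y + a₁x + a₃)` on `W`; `Literature.ModularForms.IsNeronLatticeOf W L`). Given the additivity
of `toPoint` (`toPoint_add`), there is a surjective group homomorphism `u : ℂ →+ W(ℂ)` with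
kernel `Λ`, given off `Λ` by `z ↦ (℘(z) − b₂/12, (℘'(z) − a₁(℘(z) − b₂/12) − a₃)/2)`: the
homomorphism `ℂ →+ E_Λ(ℂ)` of `exists_addMonoidHom_curve` composed with the inverse of the group
isomorphism `W(ℂ) ≃+ E_Λ(ℂ)` of Mathlib's change of variables `W.toShortNF`
(`WeierstrassCurve.VariableChange.pointEquiv`, Silverman AEC III.3.1(b)). This is the conclusion
of the named fact `Literature.NumberTheory.EllipticCurves.ModularForms.IsNeronLatticeOf.exists_uniformize`
(`ModularParametrization.lean`) for `(W, L)`. [cite: SilvermanAEC2009, Prop. VI.3.6(b)] -/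
theorem exists_addMonoidHom_of_g₂_g₃ (h : L.toPoint_add) {W : WeierstrassCurve ℂ}
    (h₂ : L.g₂ = W.c₄ / 12) (h₃ : L.g₃ = W.c₆ / 216) :
    ∃ u : ℂ →+ W.toAffine.Point,
      (u.ker : Set ℂ) = L.lattice ∧ Function.Surjective u ∧
        ∀ z ∉ L.lattice, ∃ hz,
          u z = .some (℘[L] z - W.b₂ / 12)
            ((℘'[L] z - W.a₁ * (℘[L] z - W.b₂ / 12) - W.a₃) / 2) hz := by
  -- VI.3.6(b) for any curve *equal* to `E_Λ` (substituting the equality)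
  have key : ∀ W' : WeierstrassCurve ℂ, W' = L.curve → ∃ u : ℂ →+ W'.toAffine.Point,
      (u.ker : Set ℂ) = L.lattice ∧ Function.Surjective u ∧
        ∀ z, z ∉ L.lattice → ∃ hz, u z = .some (℘[L] z) (℘'[L] z / 2) hz := by
    rintro _ rfl
    exact exists_addMonoidHom_curve h
  set C := W.toShortNF with hCdef
  obtain ⟨u, hker, hsurj, hspec⟩ := key (C • W) (toShortNF_smul_eq_curve h₂ h₃)
  let e : W.toAffine.Point ≃+ (C • W).toAffine.Point :=
    WeierstrassCurve.VariableChange.pointEquiv W C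
  refine ⟨e.symm.toAddMonoidHom.comp u, ?_, e.symm.surjective.comp hsurj, fun z hz ↦ ?_⟩
  · rw [← hker]
    ext z
    simp
  · obtain ⟨hz', hu⟩ := hspec z hz
    have hx : C.ofX (℘[L] z) = ℘[L] z - W.b₂ / 12 := by
      simp only [WeierstrassCurve.VariableChange.ofX_def, hCdef, W.toShortNF_eq, Units.val_one,
        one_pow, one_mul]
      ring
    have hy : C.ofY (℘[L] z) (℘'[L] z / 2) =
        (℘'[L] z - W.a₁ * (℘[L] z - W.b₂ / 12) - W.a₃) / 2 := by
      simp only [WeierstrassCurve.VariableChange.ofY_def, hCdef, W.toShortNF_eq, Units.val_one,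
        one_pow, one_mul]
      ring
    have hns := (WeierstrassCurve.VariableChange.nonsingular_ofXY_iff W C _ _).mpr hz'
    rw [hx, hy] at hns
    refine ⟨hns, ?_⟩
    simp only [AddMonoidHom.coe_comp, Function.comp_apply, AddEquiv.coe_toAddMonoidHom, hu, e,
      WeierstrassCurve.VariableChange.pointEquiv_symm_apply,
      WeierstrassCurve.VariableChange.pointInv_some]
    simp only [hx, hy]

end Model

end PeriodPair

end
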